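import Summits.ABC.IUTFork.Thm311RealInd1StripTwistJWSpan
import HarnessLib

/-!
# [IUTchIII] Thm 3.11 (i) (Ind1) at `v ∈ 𝕍^non`: Kondo's transvections `(φ_i)_+` and Hoshi–Nishio's basis `y_1, …, y_d` PROVED
# at every `K_v` from the group-level Jannsen–Wingberg fact — `DehnTwistTransvectionsOnUnitsAll` at `closureAt v` as a THEOREM

PROOF-ONLY file (abc-iut cell, Cor. 3.12 sub-crew, seat abc-iut-c312-1 = holder of record of the typed [IUTchIII] Thm. 3.11,
gen 11; row «R12 JW-TWISTS-FROM-PRESENTATION», part b).  TAKES NO SIDE on [IUTchIII] Cor. 3.12.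

* **`Real.dehnTwists_closureAt_of_jannsenWingberg`** — assuming the GROUP-LEVEL fact `JannsenWingbergTwists` (Jannsen–Wingberg
  1982 Thm. 2 / §5.1, NSW 7.5.14, Hoshi–Nishio 2022 Prop. 1.1, Kondo 2025 Thm. 2.1: generators `σ, τ, x_0, …, x_d` of `G_{K_v}`
  read through THE reciprocity map, topological generation of the principal units, the abelianised relation, and the twists
  `x_b ↦ x_b x_a`, `x_a ↦ x_a x_b⁻¹` on Kondo's planes), at every finite place `v ∣ p` of a number field with `p` odd and
  `d = [K_v : ℚ_p] ≥ 3`: THE BODY OF `DehnTwistTransvectionsOnUnitsAll` AT `closureAt v` — a `ℚ_p`-basis `y` of `K_v` indexed by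
  `Fin c ⊕ Fin g × Fin 2`, `c ≤ 2`, every plane carrying both elementary transvections realised by topological automorphisms
  of `G_v` through THE equivariant lift on unit logarithms.  The basis is `y_j := log θ⁻¹[x_j]`, `1 ≤ j ≤ d`
  (Hoshi–Nishio Lemma 1.3, PROVED: the logarithms of topological generators span — kit — and `y_0 ∈ ℚ_p y_1` by the
  abelianised relation `u_0^H u_1^{p^s} ∈ μ`, `H ≠ 0`); the action is Kondo's computation PROVED: `θ(liftUnits φ u) = φ^{ab}(θ u)`
  (kit) gives `liftUnits φ_i (u_b) = u_b u_a` and `liftUnits φ_i (u_j) = u_j` otherwise, whence `(φ_i)_+ = (y_b ↦ y_b + y_a)` on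
  generators, whence everywhere.  What REMAINS ASSUMED is the group-level fact (the presentation and «`ψ(r) = r`»).
HONEST SCOPE: a conditional theorem (binder `hJW`) about OUR typed objects at ONE place; the sequel re-derives the R11 statements of
record from it; nothing here asserts or refutes [IUTchIII] Cor. 3.12.  [claim: Mochizuki2012, status: disputed];
[cite: HoshiNishio2022OuterAutMLF, Lemma 1.3]; [cite: Kondo2025OuterAutMLF, §2 Thm 2.1 and proof of Thm 2.3 p.10];
[cite: JannsenWingberg1982, Thm 2 p.75 and §5.1 p.96]; [cite: NeukirchSchmidtWingberg2008, Thm 7.5.14].  typed ≠ proved;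
a conditional theorem discharges nothing it binds.
-/

set_option autoImplicit false

noncomputable section

open Metric Set
open scoped Pointwise

namespace Summit.ABC.IUTFork.Thm311.Real

open NumberField IsDedekindDomain Literature.NumberTheory.NumberFields Literature.IUT.LogVolume
open Literature.NumberTheory.GaloisRepresentations
open Literature.AnabelianGeometry.AbsoluteAnabelian Literature.IUT.HodgeArakelov
open Literature.IUT.HodgeArakelov.AbsTopMonoids

variable {F : Type} [Field F] [NumberField F] (v : HeightOneSpectrum (𝓞 F))

/-! ## 1. Kondo's indexing: `y_1, …, y_d` as `Fin c ⊕ Fin g × Fin 2`, `c ∈ {1, 2}`, planes `(c + 2i + 1, c + 2i + 2)` -/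

/-- The position of a basis index among `1, …, d`: `inl t ↦ t + 1` (the unpaired `y_1`, resp. `y_1, y_2`), `inr (i, ε) ↦ c + 2i + 1 + ε`
(Kondo's plane `i + 1`: `(a_{i+1}, b_{i+1}) = (x_{2(i+1)+1}, x_{2(i+1)+2})` for `d` even, `c = 2`; `(x_{2(i+1)}, x_{2(i+1)+1})` for `d`
odd, `c = 1`).  An explicit function, no choice. [cite: Kondo2025OuterAutMLF, §2 proof of Thm 2.3 p.10] -/
theorem jwIndex_injective (c g : ℕ) :
    Function.Injective (fun s : Fin c ⊕ Fin g × Fin 2 =>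
      Sum.elim (fun t : Fin c => (t : ℕ) + 1) (fun iε : Fin g × Fin 2 => c + 2 * (iε.1 : ℕ) + 1 + (iε.2 : ℕ)) s) := by
  rintro (t | ⟨i, ε⟩) (t' | ⟨i', ε'⟩) h <;> simp only [Sum.elim_inl, Sum.elim_inr] at h
  · exact congrArg Sum.inl (Fin.ext (by omega))
  · exfalso; have := t.2; omega
  · exfalso; have := t'.2; omega
  · have hε := ε.2; have hε' := ε'.2
    have hi : (i : ℕ) = i' := by omega
    have hε2 : (ε : ℕ) = ε' := by omega
    rw [Fin.ext hi, Fin.ext hε2]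

/-- Every `j ∈ [1, c + 2g]` is a position. [cite: Kondo2025OuterAutMLF, §2 proof of Thm 2.3 p.10] -/
theorem exists_jwIndex_eq (c g : ℕ) {j : ℕ} (hj1 : 1 ≤ j) (hj2 : j ≤ c + 2 * g) :
    ∃ s : Fin c ⊕ Fin g × Fin 2,
      Sum.elim (fun t : Fin c => (t : ℕ) + 1) (fun iε : Fin g × Fin 2 => c + 2 * (iε.1 : ℕ) + 1 + (iε.2 : ℕ)) s = j := by
  by_cases hjc : j ≤ c
  · exact ⟨Sum.inl ⟨j - 1, by omega⟩, by simp only [Sum.elim_inl]; omega⟩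
  · refine ⟨Sum.inr (⟨(j - c - 1) / 2, by omega⟩, ⟨(j - c - 1) % 2, Nat.mod_lt _ two_pos⟩), ?_⟩
    simp only [Sum.elim_inr]
    have := Nat.div_add_mod (j - c - 1) 2
    omega

/-! ## 2. The theorem -/

/-- **`DehnTwistTransvectionsOnUnitsAll` AT `closureAt v`, FROM THE GROUP-LEVEL JANNSEN–WINGBERG FACT.**  Assume
`JannsenWingbergTwists`.  At a finite place `v` of a number field `F` with ODD residue characteristic `p_v` and
`d = [K_v : ℚ_{p_v}] ≥ 3`, there are `c ≤ 2`, `g` and a `ℚ_{p_v}`-basis `y` of `K_v` indexed by `Fin c ⊕ Fin g × Fin 2` such that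
EVERY plane `i` carries BOTH elementary transvections realised by topological automorphisms of `G_v` through THE equivariant lift
on unit logarithms: `φ_i : y_{(i,1)} ↦ y_{(i,1)} + y_{(i,0)}` and `φ'_i : y_{(i,0)} ↦ y_{(i,0)} − y_{(i,1)}`
(`MLFClosure.LiftActsOnUnitLogAs`).  PROOF (Hoshi–Nishio Lemma 1.3 + Kondo's computation, both PROVED here): with the fact's
principal units `u_j` (`[x_j] = θ u_j`) and `y_j := galoisLog u_j`, the `y_j`, `j ≤ d`, span `K_v` (kit:
`mem_span_of_galoisLog_of_generators`) and `H·y_0 + p^s·y_1 = 0`, `H ≠ 0` (the abelianised relation, `log` kills torsion), so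
`y_1, …, y_d` is a basis (`basisOfTopLeSpanOfCardEqFinrank`); for Kondo's plane `(a, b)`, `θ(liftUnits φ u) = φ^{ab}(θ u)`
(kit: `liftUnits_eq_of_theta`) turns `φ(x_b) = x_b x_a`, `φ(x_j) = x_j` into `liftUnits φ (u_b) = u_b u_a`,
`liftUnits φ (u_j) = u_j`, i.e. `log ∘ liftUnits φ` = the transvection on generators, hence on all units
(`liftActsOnUnitLogAs_of_generators`).  [claim: Mochizuki2012, status: disputed]
[cite: HoshiNishio2022OuterAutMLF, Lemma 1.3] [cite: Kondo2025OuterAutMLF, §2 Thm 2.1 and proof of Thm 2.3 p.10]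
[cite: JannsenWingberg1982, Thm 2 p.75 and §5.1 p.96] -/
theorem dehnTwists_closureAt_of_jannsenWingberg (hJW : JannsenWingbergTwists) [Fact (closureAt v).residueChar.Prime]
    (hpk : ValuativeRel.valuation (v.adicCompletion F) (closureAt v).residueChar < 1) (hp2 : (closureAt v).residueChar ≠ 2)
    (hfin : haveI : CharZero (closureAt v).k := (closureAt v).instChar
      letI : Algebra ℚ_[(closureAt v).residueChar] (closureAt v).k :=
        LocalField.padicAlgebra (closureAt v).k (closureAt v).residueChar hpk
      3 ≤ Module.finrank ℚ_[(closureAt v).residueChar] (closureAt v).k) :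
    haveI : CharZero (closureAt v).k := (closureAt v).instChar
    letI : Algebra ℚ_[(closureAt v).residueChar] (closureAt v).k :=
      LocalField.padicAlgebra (closureAt v).k (closureAt v).residueChar hpk
    ∃ (c g : ℕ) (_ : c ≤ 2) (y : Module.Basis (Fin c ⊕ Fin g × Fin 2) ℚ_[(closureAt v).residueChar] (closureAt v).k),
      ∀ i : Fin g,
        (∃ φ : (ModelMLFGaloisData.galois (closureAt v).k (closureAt v).K).tmPair.Pi ≃ₜ*
            (ModelMLFGaloisData.galois (closureAt v).k (closureAt v).K).tmPair.Pi,
          (closureAt v).LiftActsOnUnitLogAs (closureAt v).residueChar hpk φ fun t =>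
            t + y.coord (Sum.inr (i, 1)) t • y (Sum.inr (i, 0))) ∧
        (∃ φ' : (ModelMLFGaloisData.galois (closureAt v).k (closureAt v).K).tmPair.Pi ≃ₜ*
            (ModelMLFGaloisData.galois (closureAt v).k (closureAt v).K).tmPair.Pi,
          (closureAt v).LiftActsOnUnitLogAs (closureAt v).residueChar hpk φ' fun t =>
            t - y.coord (Sum.inr (i, 0)) t • y (Sum.inr (i, 1))) := by
  -- notation and structures
  have hv : (((closureAt v).residueChar : ℕ) : 𝓞 F) ∈ v.asIdeal := natCast_residueChar_closureAt_mem v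
  haveI : CharZero (v.adicCompletion F) := charZero_adicCompletion v
  letI iQ : Algebra ℚ_[(closureAt v).residueChar] (v.adicCompletion F) :=
    LocalField.padicAlgebra (v.adicCompletion F) (closureAt v).residueChar hpk
  haveI : ValuativeExtension (v.adicCompletion F) (v.adicCompletion F) := ⟨fun _ _ => Iff.rfl⟩
  haveI : ContinuousSMul ℚ_[(closureAt v).residueChar] (v.adicCompletion F) :=
    continuousSMul_of_algebraMap ℚ_[(closureAt v).residueChar] _
      (by exact LocalField.continuous_algebraMap_adicCompletionPadicAlgebra v (closureAt v).residueChar hv)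
  haveI : FiniteDimensional ℚ_[(closureAt v).residueChar] (RescaledCompletion F (closureAt v).residueChar v hv) :=
    FiniteDimensional.of_locallyCompactSpace ℚ_[(closureAt v).residueChar]
  set d := Module.finrank ℚ_[(closureAt v).residueChar] (v.adicCompletion F) with hd
  have hd3 : 3 ≤ d := hfin
  -- the Jannsen–Wingberg data at `K_v`
  obtain ⟨σ, τ, x, u, s, H, -, -, hwild, hdense, hs, hH, htor, heven, hodd⟩ :=
    hJW (v.adicCompletion F) (closureAt v).residueChar hpk hp2 (by omega)
  -- the principal units `u_j` as units of `𝒪_v`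
  have hunit : ∀ j, j ≤ d → ∃ w : (↥(v.adicCompletionIntegers F))ˣ, unitsToK v w = u j := by
    intro j hj
    apply exists_unit_coe_eq
    rw [Valuation.mem_unitGroup_iff]
    have h := Valuation.map_one_add_of_lt (ValuativeRel.valuation (v.adicCompletion F)) (hwild j hj).1
    rwa [add_sub_cancel] at h
  choose! uO huO using hunit
  set S : Set (↥(v.adicCompletionIntegers F))ˣ := uO '' Set.Iic d with hSdef
  have hSmap : (Subgroup.closure S).map (unitsToK v) = Subgroup.closure (u '' Set.Iic d) := by
    rw [MonoidHom.map_closure]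
    congr 1
    ext z
    constructor
    · rintro ⟨w, ⟨j, hj, rfl⟩, rfl⟩; exact ⟨j, hj, (huO j hj).symm⟩
    · rintro ⟨j, hj, rfl⟩; exact ⟨uO j, ⟨j, hj, rfl⟩, huO j hj⟩
  have hS : ∀ w : (↥(v.adicCompletionIntegers F))ˣ,
      ValuativeRel.valuation (v.adicCompletion F) (((w : ↥(v.adicCompletionIntegers F)) : v.adicCompletion F) - 1) < 1 →
        unitsToK v w ∈ (((Subgroup.closure S).map (unitsToK v)).topologicalClosure : Subgroup (v.adicCompletion F)ˣ) := by
    intro w hw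
    rw [hSmap]
    exact hdense (unitsToK v w) hw
  -- the logarithms `y_j`, read in the rescaled completion
  set e := RescaledCompletion.of F (closureAt v).residueChar v hv with he
  let eL : v.adicCompletion F ≃ₗ[ℚ_[(closureAt v).residueChar]] RescaledCompletion F (closureAt v).residueChar v hv :=
    { e.toAddEquiv with
      map_smul' := fun c x => by
        change e (c • x) = c • e x
        rw [Algebra.smul_def, Algebra.smul_def, map_mul]
        rfl }
  have heL : ∀ z, eL z = e z := fun z => rfl
  let yR : ℕ → RescaledCompletion F (closureAt v).residueChar v hv := fun j => e (galoisLog v (Additive.ofMul (uO j)))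
  -- (Hoshi–Nishio Lemma 1.3, spanning) every element is in the span of `y_0, …, y_d`
  have hspan : ∀ z, z ∈ Submodule.span ℚ_[(closureAt v).residueChar] (yR '' Set.Iic d) := by
    intro z
    have h := mem_span_of_galoisLog_of_generators v (closureAt v).residueChar hv S hS z
    rwa [hSdef, Set.image_image] at h
  -- the abelianised relation: `H • y_0 + p^s • y_1 = 0`
  have htor' : IsOfFinOrder (uO 0 ^ H * uO 1 ^ ((closureAt v).residueChar ^ s)) := by
    have hmap : unitsToK v (uO 0 ^ H * uO 1 ^ ((closureAt v).residueChar ^ s)) =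
        u 0 ^ H * u 1 ^ ((closureAt v).residueChar ^ s) := by
      rw [map_mul, map_zpow, map_pow, huO 0 (by omega), huO 1 (by omega)]
    obtain ⟨n, hn, hpow⟩ := htor.exists_pow_eq_one
    exact isOfFinOrder_iff_pow_eq_one.mpr ⟨n, hn, unitsToK_injective v (by rw [map_pow, hmap, hpow, map_one])⟩
  have hrel : (H : ℚ_[(closureAt v).residueChar]) • yR 0 +
      (((closureAt v).residueChar ^ s : ℕ) : ℚ_[(closureAt v).residueChar]) • yR 1 = 0 := by
    obtain ⟨n, hn, hpow⟩ := htor'.exists_pow_eq_one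
    have h0 : galoisLog v (Additive.ofMul (uO 0 ^ H * uO 1 ^ ((closureAt v).residueChar ^ s))) = 0 := by
      have h1 : (n : v.adicCompletion F) *
          galoisLog v (Additive.ofMul (uO 0 ^ H * uO 1 ^ ((closureAt v).residueChar ^ s))) = 0 := by
        rw [← nsmul_eq_mul, ← map_nsmul, ← ofMul_pow, hpow, ofMul_one, map_zero]
      exact (mul_eq_zero.mp h1).resolve_left (by exact_mod_cast hn.ne')
    rw [ofMul_mul, ofMul_zpow, ofMul_pow, map_add, map_zsmul, map_nsmul] at h0
    have h1 := congrArg e h0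
    rw [map_add, map_zsmul, map_nsmul, map_zero, ← Int.cast_smul_eq_zsmul ℚ_[(closureAt v).residueChar],
      ← Nat.cast_smul_eq_nsmul ℚ_[(closureAt v).residueChar]] at h1
    exact h1
  have hy0 : yR 0 ∈ Submodule.span ℚ_[(closureAt v).residueChar] {yR 1} := by
    have hH0 : (H : ℚ_[(closureAt v).residueChar]) ≠ 0 := by exact_mod_cast hH
    have h1 : (H : ℚ_[(closureAt v).residueChar]) • yR 0 =
        -((((closureAt v).residueChar ^ s : ℕ) : ℚ_[(closureAt v).residueChar]) • yR 1) :=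
      eq_neg_of_add_eq_zero_left hrel
    have h : yR 0 = (H : ℚ_[(closureAt v).residueChar])⁻¹ •
        (-((((closureAt v).residueChar ^ s : ℕ) : ℚ_[(closureAt v).residueChar]) • yR 1)) := by
      rw [← h1, smul_smul, inv_mul_cancel₀ hH0, one_smul]
    rw [h, ← smul_neg, smul_smul]
    exact Submodule.smul_mem _ _ (Submodule.neg_mem _ (Submodule.mem_span_singleton_self _))
  -- hence `y_1, …, y_d` span
  have hspan1 : ∀ z, z ∈ Submodule.span ℚ_[(closureAt v).residueChar] (yR '' Set.Icc 1 d) := by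
    intro z
    have hsub : yR '' Set.Iic d ⊆ (Submodule.span ℚ_[(closureAt v).residueChar] (yR '' Set.Icc 1 d) :
        Set (RescaledCompletion F (closureAt v).residueChar v hv)) := by
      rintro _ ⟨j, hj, rfl⟩
      rcases Nat.eq_zero_or_pos j with rfl | hjpos
      · refine Submodule.span_mono ?_ hy0
        rintro _ rfl
        exact ⟨1, ⟨le_rfl, by omega⟩, rfl⟩
      · exact Submodule.subset_span ⟨j, ⟨hjpos, hj⟩, rfl⟩
    exact Submodule.span_le.mpr hsub (hspan z)
  -- Kondo's indexing
  let c : ℕ := if Even d then 2 else 1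
  have hc2 : c ≤ 2 := by by_cases h : Even d <;> simp only [c, h, if_true, if_false] <;> omega
  have hc1 : 1 ≤ c := by by_cases h : Even d <;> simp only [c, h, if_true, if_false] <;> omega
  let g : ℕ := (d - c) / 2
  have hcg : c + 2 * g = d := by
    by_cases h : Even d
    · obtain ⟨m, hm⟩ := h
      simp only [c, g, if_pos (show Even d from ⟨m, hm⟩)]
      omega
    · obtain ⟨m, hm⟩ := Nat.not_even_iff_odd.mp h
      simp only [c, g, if_neg h]
      omega
  let idx : Fin c ⊕ Fin g × Fin 2 → ℕ := fun s' =>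
    Sum.elim (fun t : Fin c => (t : ℕ) + 1) (fun iε : Fin g × Fin 2 => c + 2 * (iε.1 : ℕ) + 1 + (iε.2 : ℕ)) s'
  have hidx_inj : Function.Injective idx := jwIndex_injective c g
  have hidx_mem : ∀ s', 1 ≤ idx s' ∧ idx s' ≤ d := by
    rintro (t | ⟨i, ε⟩)
    · have := t.2; simp only [idx, Sum.elim_inl]; omega
    · have := i.2; have := ε.2; simp only [idx, Sum.elim_inr]; omega
  -- the basis of `K_v^{(1/n_v)}`, then of `K_v`
  let bfam : Fin c ⊕ Fin g × Fin 2 → RescaledCompletion F (closureAt v).residueChar v hv := fun s' => yR (idx s')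
  have hle : ⊤ ≤ Submodule.span ℚ_[(closureAt v).residueChar] (Set.range bfam) := by
    intro z _
    have hsub : yR '' Set.Icc 1 d ⊆ Set.range bfam := by
      rintro _ ⟨j, ⟨hj1, hj2⟩, rfl⟩
      obtain ⟨s', hs'⟩ := exists_jwIndex_eq c g hj1 (by omega)
      exact ⟨s', by simp only [bfam, idx]; rw [hs']⟩
    exact Submodule.span_mono hsub (hspan1 z)
  have hcard : Fintype.card (Fin c ⊕ Fin g × Fin 2) =
      Module.finrank ℚ_[(closureAt v).residueChar] (RescaledCompletion F (closureAt v).residueChar v hv) := by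
    rw [← eL.finrank_eq, Fintype.card_sum, Fintype.card_prod, Fintype.card_fin, Fintype.card_fin, Fintype.card_fin]
    omega
  let bR : Module.Basis (Fin c ⊕ Fin g × Fin 2) ℚ_[(closureAt v).residueChar]
      (RescaledCompletion F (closureAt v).residueChar v hv) := basisOfTopLeSpanOfCardEqFinrank bfam hle hcard
  have hbR : ∀ s', bR s' = yR (idx s') := fun s' => by
    change (basisOfTopLeSpanOfCardEqFinrank bfam hle hcard : _ → _) s' = _
    rw [coe_basisOfTopLeSpanOfCardEqFinrank]
  let y : Module.Basis (Fin c ⊕ Fin g × Fin 2) ℚ_[(closureAt v).residueChar] (v.adicCompletion F) := bR.map eL.symm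
  have hy : ∀ s', y s' = galoisLog v (Additive.ofMul (uO (idx s'))) := fun s' => by
    change eL.symm (bR s') = _
    rw [hbR]
    exact e.symm_apply_apply _
  have hycoord : ∀ s' t, y.coord s' t = bR.coord s' (e t) := by
    intro s' t
    change (bR.map eL.symm).repr t s' = bR.repr (eL t) s'
    rw [Module.Basis.map_repr, LinearEquiv.trans_apply, LinearEquiv.symm_symm]
  -- coordinates of the `y_j`, `j ≤ d`, at a plane index
  have hcoord : ∀ (s₀ : Fin c ⊕ Fin g × Fin 2) (j : ℕ), j ≤ d → (∃ iε : Fin g × Fin 2, s₀ = Sum.inr iε) →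
      bR.coord s₀ (yR j) = if j = idx s₀ then 1 else 0 := by
    rintro s₀ j hj ⟨iε₀, rfl⟩
    rcases Nat.eq_zero_or_pos j with rfl | hjpos
    · -- `y_0 = λ • y_1 = λ • bR (inl 0)`
      have h1d : 1 ≤ d := by omega
      obtain ⟨s₁, hs₁⟩ := exists_jwIndex_eq c g (le_refl 1) (by omega : 1 ≤ c + 2 * g)
      have hs₁' : idx s₁ = 1 := hs₁
      obtain ⟨t₁, rfl⟩ : ∃ t : Fin c, s₁ = Sum.inl t := by
        rcases s₁ with t | ⟨i, ε⟩
        · exact ⟨t, rfl⟩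
        · exfalso; simp only [idx, Sum.elim_inr] at hs₁'; omega
      obtain ⟨q, hq⟩ := Submodule.mem_span_singleton.mp hy0
      have hne : (0 : ℕ) ≠ idx (Sum.inr iε₀) := by have := (hidx_mem (Sum.inr iε₀)).1; omega
      rw [if_neg hne, ← hq, ← hs₁', ← hbR, map_smul, Module.Basis.coord_apply, Module.Basis.repr_self,
        Finsupp.single_apply, if_neg (by simp), smul_zero]
    · obtain ⟨s₁, hs₁⟩ := exists_jwIndex_eq c g hjpos (by omega)
      have hs₁' : idx s₁ = j := hs₁
      rw [← hs₁', ← hbR, Module.Basis.coord_apply, Module.Basis.repr_self, Finsupp.single_apply]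
      by_cases h : s₁ = Sum.inr iε₀
      · subst h; rw [if_pos rfl, if_pos rfl]
      · rw [if_neg h, if_neg (fun h' => h (hidx_inj h'))]
  -- the answer
  refine ⟨c, g, hc2, y, fun i => ?_⟩
  -- Kondo's plane `i + 1`: `(a, b) = (idx (inr (i,0)), idx (inr (i,1)))`
  have hab : idx (Sum.inr (i, 1)) = idx (Sum.inr (i, 0)) + 1 := by simp only [idx, Sum.elim_inr, Fin.val_zero, Fin.val_one]
  have hplane : JWTwistPair σ τ x d (idx (Sum.inr (i, 0))) (idx (Sum.inr (i, 1))) := by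
    have hi := i.2
    by_cases hev : Even d
    · have hc : c = 2 := if_pos hev
      have h := heven hev ((i : ℕ) + 1) (by omega) (by omega)
      have ha : idx (Sum.inr (i, 0)) = 2 * ((i : ℕ) + 1) + 1 := by
        simp only [idx, Sum.elim_inr, Fin.val_zero]; omega
      have hb : idx (Sum.inr (i, 1)) = 2 * ((i : ℕ) + 1) + 2 := by
        simp only [idx, Sum.elim_inr, Fin.val_one]; omega
      rw [ha, hb]; exact h
    · have hc : c = 1 := if_neg hev
      have h := hodd (Nat.not_even_iff_odd.mp hev) ((i : ℕ) + 1) (by omega) (by omega)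
      have ha : idx (Sum.inr (i, 0)) = 2 * ((i : ℕ) + 1) := by
        simp only [idx, Sum.elim_inr, Fin.val_zero]; omega
      have hb : idx (Sum.inr (i, 1)) = 2 * ((i : ℕ) + 1) + 1 := by
        simp only [idx, Sum.elim_inr, Fin.val_one]; omega
      rw [ha, hb]; exact h
  have ha_le : idx (Sum.inr (i, 0)) ≤ d := (hidx_mem _).2
  have hb_le : idx (Sum.inr (i, 1)) ≤ d := (hidx_mem _).2
  have hab_ne : idx (Sum.inr (i, 0)) ≠ idx (Sum.inr (i, 1)) := by omega
  -- `[x_j] = θ (u_j)` on the units of `𝒪_v`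
  have hθ : ∀ j, j ≤ d → absGaloisAbProj (v.adicCompletion F) (x j) =
      (LocalWeilDatum.isReciprocitySystemE (F := v.adicCompletion F) (E := v.adicCompletion F)
        (LocalWeilDatum.isClassFieldTheory_localWeilDatum (v.adicCompletion F))).theta (unitsToK v (uO j)) := by
    intro j hj; rw [huO j hj]; exact (hwild j hj).2
  obtain ⟨⟨φ, -, -, hφfix, hφb⟩, ⟨φ', -, -, hφ'fix, hφ'a⟩⟩ := hplane
  constructor
  · -- `φ_i : x_b ↦ x_b x_a`
    refine ⟨φ, ?_⟩
    -- the action on the generators `u_j`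
    have hLfix : ∀ j, j ≤ d → j ≠ idx (Sum.inr (i, 1)) → liftUnits v φ (uO j) = uO j := fun j hj hjb =>
      liftUnits_eq_of_theta v φ (hθ j hj)
        ((congrArg (absGaloisAbProj (v.adicCompletion F)) (hφfix j hj hjb)).trans (hθ j hj))
    have hLb : liftUnits v φ (uO (idx (Sum.inr (i, 1)))) = uO (idx (Sum.inr (i, 1))) * uO (idx (Sum.inr (i, 0))) :=
      liftUnits_eq_of_theta v φ (hθ _ hb_le)
        ((congrArg (absGaloisAbProj (v.adicCompletion F)) hφb).trans
          (by rw [map_mul, map_mul, map_mul, hθ _ hb_le, hθ _ ha_le]))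
    -- the transvection as a linear map
    let T : v.adicCompletion F →ₗ[ℚ_[(closureAt v).residueChar]] v.adicCompletion F :=
      LinearMap.id + (y.coord (Sum.inr (i, 1))).smulRight (y (Sum.inr (i, 0)))
    have hT : ∀ t, T t = t + y.coord (Sum.inr (i, 1)) t • y (Sum.inr (i, 0)) := fun t => rfl
    have hgenT : ∀ s' ∈ S, galoisLog v (Additive.ofMul (liftUnits v φ s')) = T (galoisLog v (Additive.ofMul s')) := by
      rintro _ ⟨j, hj, rfl⟩
      rw [hT, hycoord, hy]
      change _ = _ + bR.coord (Sum.inr (i, 1)) (yR j) • _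
      rw [hcoord _ j hj ⟨(i, 1), rfl⟩]
      by_cases hjb : j = idx (Sum.inr (i, 1))
      · rw [if_pos hjb, one_smul, hjb, hLb, ofMul_mul, map_add]
      · rw [if_neg hjb, zero_smul, add_zero, hLfix j hj hjb]
    exact fun xx xx' aa aa' t t' h1 h2 h3 h4 h5 h6 =>
      (liftActsOnUnitLogAs_of_generators v hpk S hS φ T hgenT xx xx' aa aa' t t' h1 h2 h3 h4 h5 h6).trans (hT t)
  · -- `φ'_i : x_a ↦ x_a x_b⁻¹`
    refine ⟨φ', ?_⟩
    have hLfix : ∀ j, j ≤ d → j ≠ idx (Sum.inr (i, 0)) → liftUnits v φ' (uO j) = uO j := fun j hj hja =>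
      liftUnits_eq_of_theta v φ' (hθ j hj)
        ((congrArg (absGaloisAbProj (v.adicCompletion F)) (hφ'fix j hj hja)).trans (hθ j hj))
    have hLa : liftUnits v φ' (uO (idx (Sum.inr (i, 0)))) = uO (idx (Sum.inr (i, 0))) * (uO (idx (Sum.inr (i, 1))))⁻¹ :=
      liftUnits_eq_of_theta v φ' (hθ _ ha_le)
        ((congrArg (absGaloisAbProj (v.adicCompletion F)) hφ'a).trans
          (by rw [map_mul, map_inv, map_mul, map_inv, map_mul, map_inv, hθ _ ha_le, hθ _ hb_le]))
    let T : v.adicCompletion F →ₗ[ℚ_[(closureAt v).residueChar]] v.adicCompletion F :=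
      LinearMap.id - (y.coord (Sum.inr (i, 0))).smulRight (y (Sum.inr (i, 1)))
    have hT : ∀ t, T t = t - y.coord (Sum.inr (i, 0)) t • y (Sum.inr (i, 1)) := fun t => rfl
    have hgenT : ∀ s' ∈ S, galoisLog v (Additive.ofMul (liftUnits v φ' s')) = T (galoisLog v (Additive.ofMul s')) := by
      rintro _ ⟨j, hj, rfl⟩
      rw [hT, hycoord, hy]
      change _ = _ - bR.coord (Sum.inr (i, 0)) (yR j) • _
      rw [hcoord _ j hj ⟨(i, 0), rfl⟩]
      by_cases hja : j = idx (Sum.inr (i, 0))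
      · rw [if_pos hja, one_smul, hja, hLa, ofMul_mul, ofMul_inv, map_add, map_neg, sub_eq_add_neg]
      · rw [if_neg hja, zero_smul, sub_zero, hLfix j hj hja]
    exact fun xx xx' aa aa' t t' h1 h2 h3 h4 h5 h6 =>
      (liftActsOnUnitLogAs_of_generators v hpk S hS φ' T hgenT xx xx' aa aa' t t' h1 h2 h3 h4 h5 h6).trans (hT t)

end Summit.ABC.IUTFork.Thm311.Real

end
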